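import Mathlib
import Summits.ValiantsHypothesis.ValiantsHypothesis.Theorems.DivisionGapZeroOneTransferFaceIsolationDefs
import Summits.ValiantsHypothesis.ValiantsHypothesis.Theorems.DivisionGapZeroOneTransferFaceEngine
import Summits.ValiantsHypothesis.ValiantsHypothesis.Theorems.DivisionGapZeroOneTransferTriPMPowLowerBound

/-!
# Crux `DivisionGap.ZeroOneTransfer` (stmt-ValiantsHypothesis-5066), line `charged-uncharged`, Part E (lead c13) —
stub `stub_faceEnginePow` (E1', THE FACE ENGINE FOR POWERS)

For an edge predicate `E₀` on the rhombus `R_n` containing every triangular edge with both ends in the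
square block `B = [r₀, r₀+m) × [c₀, c₀+m)` (`m ≥ 64` even) and such that the complement of `B` carries a
cover inside `E₀` in normal form, and for any monomial `a x^u` (`a ≠ 0`), every power of the
edge-restricted dimer polynomial `D_n[E₀] = triPMIn E₀` satisfies the uniform power bound for `D_m` up
to the JSS polynomial loss:
`T^L ≤ (((n²+2)(L₊(D_n[E₀]^{M+1} · a x^u) + 3))^κ + 1) · (T-1)^L` for `24 L + 60 ≤ m`.

Proof (the proof of `stub_faceEngine`, with the first power replaced by all powers).  The block
substitution `blockSubst` is a ring homomorphism and a positive projection mapping `D_n[E₀]` to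
`c • D_m` with `c ≠ 0` (`FaceEngine.exists_smul_blockSubst`, `FaceEngine.blockSubst_isProj`), hence it
maps `D_n[E₀]^{M+1}` to `c^{M+1} • D_m^{M+1}`, so `L₊(c^{M+1} • D_m^{M+1}) ≤ L₊(D_n[E₀]^{M+1})`
(`complexity_le_of_isProjection`); one scalar gate undoes the nonzero scalar
(`complexity_smul_le_holds`), and the uniform power bound `triPM_pow_lower_bound`
(`T^L ≤ L₊(D_m^{M+1}) · (T-1)^L`) applies.  Finally JSS contraction on vertex-indexed variables
(`MmMonomialInitialForm.jssContraction_vtx`) and one scalar gate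
(`MonomialTop.complexity_monomial_one_mul_le`) bound `L₊(D_n[E₀]^{M+1})` by
`((n²+2)(L₊(D_n[E₀]^{M+1} · a x^u) + 3))^κ`.
[cite: Valiant1980, §3 Thm 1] [cite: JuknaSeiwertSergeev2022, Lemma 2]
-/

noncomputable section

set_option linter.dupNamespace false

namespace Summit.ValiantsHypothesis.ValiantsHypothesis.Theorems.DivisionGapZeroOneTransfer

open MvPolynomial
open Literature.Computability.AlgebraicComplexity
open Summit.ValiantsHypothesis.ValiantsHypothesis.Theorems.TriangularDimersDivisionEasy.Negative
open Summit.ValiantsHypothesis.ValiantsHypothesis.Theorems.ZeroOneTransfer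
open FaceIsolation
open scoped NNReal BigOperators

/-- **Stub E1' — THE FACE ENGINE FOR POWERS.**  For an edge predicate `E₀` containing every triangular
edge inside the block `[r₀, r₀+m) × [c₀, c₀+m)` (`m ≥ 64` even) and admitting a cover of the block's
complement inside `E₀` (in normal form), any monomial `a·x^u` (`a ≠ 0`) and any exponent `M + 1`:
`T^L ≤ (((n²+2)(L₊(D_n[E₀]^{M+1} · a x^u) + 3))^κ + 1) · (T-1)^L` for `24L + 60 ≤ m` — JSS contraction
strips the monomial, the block substitution (a positive projection and a ring homomorphism) maps
`D_n[E₀]^{M+1}` to `c^{M+1} • D_m^{M+1}`, `c ≠ 0`, one scalar gate removes the scalar, and the uniform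
power bound `triPM_pow_lower_bound` for `D_m^{M+1}` applies.
[cite: Valiant1980, §3 Thm 1] [cite: JuknaSeiwertSergeev2022, Lemma 2] -/
theorem stub_faceEnginePow :
    ∃ κ : ℕ, ∀ (n : ℕ) (E₀ : Vtx n → Vtx n → Prop) [DecidableRel E₀] (u : Var n →₀ ℕ) (a : ℝ≥0),
      a ≠ 0 → ∀ (r₀ c₀ m M : ℕ), 64 ≤ m → Even m → r₀ + m ≤ n → c₀ + m ≤ n →
      (∀ v w : Vtx n, InBlock r₀ c₀ m v → InBlock r₀ c₀ m w → Adj v w → E₀ v w) →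
      (∃ g : Vtx n → Vtx n, ∀ v, ¬ InBlock r₀ c₀ m v →
          g (g v) = v ∧ g v ≠ v ∧ Adj v (g v) ∧ ¬ InBlock r₀ c₀ m (g v) ∧ E₀ v (g v)) →
      ∀ L : ℕ, 24 * L + 60 ≤ m →
        Tfib ^ L ≤ (((n * n + 2) * (complexity (triPMIn E₀ ^ (M + 1) * monomial u a) + 3)) ^ κ + 1) *
          (Tfib - 1) ^ L := by
  obtain ⟨κ, hκ⟩ := MmMonomialInitialForm.jssContraction_vtx
  refine ⟨κ, fun n E₀ _ u a ha r₀ c₀ m M h64 hme hr hc hblk hg L hL => ?_⟩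
  have hm : 0 < m := by omega
  -- (1) the block substitution maps `D_n[E₀]` to `c • D_m`, `c ≠ 0`
  obtain ⟨c, hc0, heq⟩ := FaceEngine.exists_smul_blockSubst E₀ hm hr hc hblk hg
  -- (2) it is a ring hom and a positive projection: `D_n[E₀]^{M+1} ↦ c^{M+1} • D_m^{M+1}` for free
  have hproj : IsProjection (c ^ (M + 1) • triPM m ^ (M + 1)) (triPMIn E₀ ^ (M + 1)) := by
    refine ⟨blockSubst r₀ c₀ m hm, FaceEngine.blockSubst_isProj hm, ?_⟩
    rw [map_pow, heq, smul_pow]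
  have hcx : complexity (c ^ (M + 1) • triPM m ^ (M + 1)) ≤ complexity (triPMIn E₀ ^ (M + 1)) :=
    complexity_le_of_isProjection hproj
  -- (3) one scalar gate undoes the nonzero scalar `c^{M+1}`
  have hsm : complexity (triPM m ^ (M + 1)) ≤
      complexity (c ^ (M + 1) • triPM m ^ (M + 1)) + 1 := by
    have h := complexity_smul_le_holds (c ^ (M + 1))⁻¹ (c ^ (M + 1) • triPM m ^ (M + 1))
    rwa [inv_smul_smul₀ (pow_ne_zero _ hc0)] at h
  -- (4) the uniform power bound for `D_m^{M+1}`
  have hval : Tfib ^ L ≤ complexity (triPM m ^ (M + 1)) * (Tfib - 1) ^ L :=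
    triPM_pow_lower_bound m (M + 1) hme h64 (by omega) L hL
  -- (5) JSS contraction strips the monomial cofactor
  have h1 : complexity (monomial u (1 : ℝ≥0) * triPMIn E₀ ^ (M + 1)) ≤
      complexity (triPMIn E₀ ^ (M + 1) * monomial u a) + 1 :=
    MonomialTop.complexity_monomial_one_mul_le (triPMIn E₀ ^ (M + 1)) u ha
  have h2 : complexity (triPMIn E₀ ^ (M + 1)) ≤
      ((n * n + 2) * (complexity (triPMIn E₀ ^ (M + 1) * monomial u a) + 3)) ^ κ :=
    (hκ n (triPMIn E₀ ^ (M + 1)) u).trans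
      (Nat.pow_le_pow_left (Nat.mul_le_mul_left (n * n + 2) (by omega)) κ)
  calc Tfib ^ L ≤ complexity (triPM m ^ (M + 1)) * (Tfib - 1) ^ L := hval
    _ ≤ (((n * n + 2) * (complexity (triPMIn E₀ ^ (M + 1) * monomial u a) + 3)) ^ κ + 1) *
          (Tfib - 1) ^ L :=
        Nat.mul_le_mul_right _ (hsm.trans (Nat.succ_le_succ (hcx.trans h2)))

end Summit.ValiantsHypothesis.ValiantsHypothesis.Theorems.DivisionGapZeroOneTransfer

end
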